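import Mathlib
import HarnessLib
import Summits.HubbardSuperconductivity.HubbardSuperconductivity.Theorems.KLProgrammeSWaveCascadeSources

/-!
# Route `KLProgramme` — signed-weight bookkeeping for the s-wave-dressed Cooper cascade
# (row 0′ of child 1 under the candidate Δ21 repair: sign-indefinite slice pair-bubble weights at the class edge)

Cell gate-hubbard-kl, seat hubbard-kl-k3c1-p2 (child 1 `BetaSplitP`, technique «row-0′ V4/S twin induction measured from its own
constant»).  The weighted product `A ∗_w B`, the weighted row/column sums and the implicit-step uniqueness of p3's / r2d-p1's cascade
algebra (`…SWaveCascadeAlgebra`, `…SWaveCascadeVarying`) are stated there for weights `w ≥ 0`; here are the versions for weights of EITHER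
sign that `sWaveCascade_envelope_signed` (`…SWaveCascadeSigned`) needs: norm bounds through the ℓ¹ mass `Σ_u |w u|`
(`esup_wmul_le_abs`, `norm_sum_mul_le_abs`, `norm_sum_mul_le_abs'`, `sum_le_sum_abs`), uniqueness of the implicit step from the NET mass
`Σ_u w u ≥ 0` (`eq_zero_of_add_smul_wmul_onesArr_of_sum_nonneg`), and the growth-factor inequality `(1+y)²(1 − s − 3y) ≤ 1 − s`
(`one_add_sq_mul_le`).  Everything is proved; no definitions.
-/

noncomputable section

namespace Summit.HubbardSuperconductivity.HubbardSuperconductivity.Theorems.SWaveCascade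

set_option linter.dupNamespace false -- summit = problem name (single-conjunct summit), D-0017

open Finset

variable {S : Type*} [Fintype S]

/-- **Submultiplicativity with the ℓ¹ mass**: `esup (A ∗_w B) ≤ esup A · (Σ|w|) · esup B` (no sign condition on `w`). -/
theorem esup_wmul_le_abs (w : S → ℝ) (A B : S → S → ℂ) : esup (wmul w A B) ≤ esup A * (∑ u, |w u|) * esup B := by
  refine esup_le (fun s t => ?_)
    (mul_nonneg (mul_nonneg (esup_nonneg A) (sum_nonneg fun u _ => abs_nonneg (w u))) (esup_nonneg B))
  calc ‖wmul w A B s t‖ ≤ ∑ u, ‖A s u * (w u : ℂ) * B u t‖ := norm_sum_le _ _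
    _ ≤ ∑ u, esup A * |w u| * esup B := sum_le_sum fun u _ => by
        rw [norm_mul, norm_mul, Complex.norm_real, Real.norm_eq_abs]
        exact mul_le_mul (mul_le_mul_of_nonneg_right (le_esup A s u) (abs_nonneg _)) (le_esup B u t) (norm_nonneg _)
          (mul_nonneg (esup_nonneg A) (abs_nonneg _))
    _ = esup A * (∑ u, |w u|) * esup B := by rw [mul_sum, sum_mul]

/-- A signed weighted sum of entries bounded by `r` is bounded by `(Σ|w|)·r`. -/
theorem norm_sum_mul_le_abs {w : S → ℝ} {f : S → ℂ} {r : ℝ} (hf : ∀ u, ‖f u‖ ≤ r) :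
    ‖∑ u, f u * (w u : ℂ)‖ ≤ (∑ u, |w u|) * r := by
  calc ‖∑ u, f u * (w u : ℂ)‖ ≤ ∑ u, ‖f u * (w u : ℂ)‖ := norm_sum_le _ _
    _ ≤ ∑ u, |w u| * r := sum_le_sum fun u _ => by
        rw [norm_mul, Complex.norm_real, Real.norm_eq_abs, mul_comm]
        exact mul_le_mul_of_nonneg_left (hf u) (abs_nonneg _)
    _ = (∑ u, |w u|) * r := by rw [sum_mul]

/-- The same with the weight on the left. -/
theorem norm_sum_mul_le_abs' {w : S → ℝ} {f : S → ℂ} {r : ℝ} (hf : ∀ u, ‖f u‖ ≤ r) :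
    ‖∑ u, (w u : ℂ) * f u‖ ≤ (∑ u, |w u|) * r := by
  have := norm_sum_mul_le_abs (w := w) hf
  rwa [show (∑ u, (w u : ℂ) * f u) = ∑ u, f u * (w u : ℂ) from sum_congr rfl fun u _ => mul_comm _ _]

/-- The net mass is at most the ℓ¹ mass. -/
theorem sum_le_sum_abs (w : S → ℝ) : ∑ u, w u ≤ ∑ u, |w u| := sum_le_sum fun _ _ => le_abs_self _

/-- Uniqueness for the implicit step with signed weights: `Z + U·(Z ∗_w J) = 0` with `U ≥ 0` and NET mass `Σ w ≥ 0` forces `Z = 0`. -/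
theorem eq_zero_of_add_smul_wmul_onesArr_of_sum_nonneg {w : S → ℝ} (hW : 0 ≤ ∑ u, w u) {U : ℝ} (hU : 0 ≤ U)
    {Z : S → S → ℂ} (h : Z + (U : ℂ) • wmul w Z onesArr = 0) : Z = 0 := by
  have hrow : ∀ s, ∑ u, Z s u * (w u : ℂ) = 0 := by
    intro s
    have hs : ∀ t, Z s t + (U : ℂ) * ∑ u, Z s u * (w u : ℂ) = 0 := fun t => by
      have := congrFun (congrFun h s) t
      simpa [wmul, onesArr] using this
    set A : ℂ := ∑ u, Z s u * (w u : ℂ) with hA_def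
    have hZ : ∀ t, Z s t = -((U : ℂ) * A) := fun t => eq_neg_of_add_eq_zero_left (hs t)
    have hA : A = -((U : ℂ) * A) * ∑ t, (w t : ℂ) := by
      calc A = ∑ t, Z s t * (w t : ℂ) := rfl
        _ = ∑ t, -((U : ℂ) * A) * (w t : ℂ) := sum_congr rfl fun t _ => by rw [hZ t]
        _ = -((U : ℂ) * A) * ∑ t, (w t : ℂ) := (mul_sum _ _ _).symm
    have hsum : A * (1 + (U : ℂ) * ∑ t, (w t : ℂ)) = 0 := by linear_combination hA
    have hne : (1 + (U : ℂ) * ∑ t, (w t : ℂ)) ≠ 0 := by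
      have : (1 + (U : ℂ) * ∑ t, (w t : ℂ)) = (((1 + U * ∑ t, w t : ℝ)) : ℂ) := by push_cast; ring
      rw [this]; exact_mod_cast (by nlinarith : (0 : ℝ) < 1 + U * ∑ t, w t).ne'
    exact (mul_eq_zero.1 hsum).resolve_right hne
  funext s t
  have := congrFun (congrFun h s) t
  simp only [Pi.add_apply, Pi.smul_apply, smul_eq_mul, Pi.zero_apply, wmul, onesArr, mul_one] at this
  rw [hrow s, mul_zero, add_zero] at this
  exact this

/-- The growth-factor bookkeeping: `(1 + y)² (1 − s − 3y) ≤ 1 − s` for `y, s ≥ 0`. -/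
theorem one_add_sq_mul_le {y s : ℝ} (hy : 0 ≤ y) (hs : 0 ≤ s) : (1 + y) ^ 2 * (1 - s - 3 * y) ≤ 1 - s := by
  nlinarith [mul_nonneg hy hs, sq_nonneg y, mul_nonneg (mul_nonneg hy hy) hy, mul_nonneg (sq_nonneg y) hs]


end Summit.HubbardSuperconductivity.HubbardSuperconductivity.Theorems.SWaveCascade

end
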